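import Literature.NumberTheory.Automorphic.UnitaryGroupOrbitalTermsCurrency
import Literature.NumberTheory.Automorphic.UnitaryGroupTraceClasses
import HarnessLib

/-!
# The orbital terms of the ANISOTROPIC inner form against an honest all-classes family: the admissibility hypothesis of
# ★ `UnitaryGroupOrbitalTermsCurrency` discharged
(Rogawski, *Automorphic representations of unitary groups in three variables* (1990), §14.5 p. 237 (print): `J_{G′}(f′) = Σ_γ a_γ Φ(γ, f′)` over
ALL (semisimple) classes of the anisotropic `G′`; Deitmar–Echterhoff (2014), Lemma 9.3.3: for a uniform lattice `Γ ≤ G` and `γ ∈ Γ` the centraliser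
`G_γ` is unimodular and `Γ_γ \ G_γ` compact)

Topic `NumberTheory/Automorphic`; namespace `Literature.NumberTheory.Automorphic.UnitaryGroup`; THEOREMS ONLY (no def, no instance, no named fact, no
`sorry`).  Ruling #23 (3)(i) ∕ #25 of the F0/P3a cell: ★ (O-H) `UnitaryGroupOrbitalTermsCurrency` reads the genuine orbital terms `Φ F [γ]` against ANY
family `μ` of adelic orbital measures admissible at EVERY rational class (`SMulInvariantMeasure ∧ IsFiniteMeasureOnCompacts ∧ μ c ≠ 0`); such a family
EXISTS for anisotropic `H` in every rank — ★ `UnitaryGroupTraceClasses` (`exists_smulInvariantMeasure_quotient_centralizer_cmDatum`: `U(H)(L⁺)` is a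
uniform lattice, so every rational centraliser `U(H)(𝔸)_γ` is unimodular, regular, central and SINGULAR classes alike) — so the hypothesis is
discharged BY NAME:

* `exists_adelicOrbitalMeasureFamily_admissible_of_anisotropic` — an all-classes admissible ★ `AdelicOrbitalMeasureFamily` (choice over ★
  `exists_smulInvariantMeasure_quotient_centralizer_cmDatum`, class by class; any Borel structures on the orbit quotients);
* `IsOrbitalTerms.exists_weight_orbitalSum_eq_of_anisotropic` — for genuine orbital terms `Φ` (★ `IsOrbitalTerms`) there are an all-classes admissible
  `μ` and weights `a > 0` with `𝒪_st.orbitalSum (Φ F) = 𝒪_st.orbitalSum ([γ] ↦ a[γ] · Φ_μ(γ, F))` for every `F` and every stable class;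
* **`exists_weight_diagTrace_eq_finsum_orbitalSum_of_anisotropic`** — T1a for the anisotropic `G′` against an honest all-classes family, NO hypothesis
  left: `θ_{G′}(F) = Σᶠ_{𝒪_st} 𝒪_st.orbitalSum ([γ] ↦ a[γ] · Φ_μ(γ, F))` with `a > 0`, finitely supported summands, `μ` admissible everywhere.

## References
* J. D. Rogawski, *Automorphic Representations of Unitary Groups in Three Variables*, Ann. of Math. Stud. 123 (1990), §14.5 p. 237 [Rogawski1990].
* A. Deitmar, S. Echterhoff, *Principles of Harmonic Analysis*, 2nd ed. (2014), Lemma 9.3.3, Thm. 1.5.3 [DeitmarEchterhoff2014].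
-/

noncomputable section

open MeasureTheory Measure Set Filter Topology NumberField CompactlySupported
open Literature.MeasureTheory.Group
open scoped ENNReal NNReal Pointwise

namespace Literature.NumberTheory.Automorphic

namespace UnitaryGroup

open Literature.NumberTheory.Rogawski1990
open Literature.AlgebraicGeometry.ShimuraVarieties (hermForm)

variable (L : Type) [Field L] [NumberField L] [IsCMField L] (N : ℕ) (H : Matrix (Fin N) (Fin N) L)
  [instMS : ∀ g : (cmDatum L N H).Adelic,
    MeasurableSpace ((cmDatum L N H).Adelic ⧸ Subgroup.centralizer ({g} : Set (cmDatum L N H).Adelic))]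
  [instBS : ∀ g : (cmDatum L N H).Adelic,
    BorelSpace ((cmDatum L N H).Adelic ⧸ Subgroup.centralizer ({g} : Set (cmDatum L N H).Adelic))]

/-- **For anisotropic `H` (every rank) there is a family of adelic orbital measures admissible at EVERY rational class** — non-zero,
`U(H)(𝔸)`-invariant, finite on compact sets on `U(H)(𝔸) ⧸ U(H)(𝔸)_{γ_c}` for all `c` (★ `exists_smulInvariantMeasure_quotient_centralizer_cmDatum`:
every rational centraliser is unimodular because `U(H)(L⁺)` is a uniform lattice; regular, central and singular classes alike).
[cite: Rogawski1990, §14.5 p. 237] [cite: DeitmarEchterhoff2014, Lemma 9.3.3] -/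
theorem exists_adelicOrbitalMeasureFamily_admissible_of_anisotropic
    (hanis : ∀ x : Fin N → L, hermForm (cmConjRingHom L) H x x = 0 → x = 0) :
    ∃ μ : AdelicOrbitalMeasureFamily L N H, ∀ c : ConjClasses (cmDatum L N H).Rational,
      SMulInvariantMeasure (cmDatum L N H).Adelic _ (μ c) ∧ IsFiniteMeasureOnCompacts (μ c) ∧ μ c ≠ 0 := by
  borelize (cmDatum L N H).Adelic
  have key : ∀ c : ConjClasses (cmDatum L N H).Rational,
      ∃ m : Measure ((cmDatum L N H).Adelic ⧸
          Subgroup.centralizer ({(cmDatum L N H).toAdelic (Quotient.out c)} : Set (cmDatum L N H).Adelic)),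
        SMulInvariantMeasure (cmDatum L N H).Adelic _ m ∧ IsFiniteMeasureOnCompacts m ∧ m ≠ 0 := fun c =>
    exists_smulInvariantMeasure_quotient_centralizer_cmDatum L N H hanis ⟨Quotient.out c, rfl⟩
  exact ⟨fun c => (key c).choose, fun c => (key c).choose_spec⟩

/-- **The genuine orbital terms against an honest all-classes family, anisotropic `H`**: for `Φ` with ★ `IsOrbitalTerms L N H Φ` there are a
family `μ` admissible at every class and weights `a > 0` with `𝒪_st.orbitalSum (Φ F) = 𝒪_st.orbitalSum ([γ] ↦ a[γ] · Φ_μ(γ, F))` for every `F` and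
every stable class (★ `IsOrbitalTerms.exists_weight_orbitalSum_eq_of_admissible` at the family above). [cite: Rogawski1990, §14.5 p. 237] -/
theorem IsOrbitalTerms.exists_weight_orbitalSum_eq_of_anisotropic
    {Φ : C_c((cmDatum L N H).Adelic, ℂ) → ConjClasses (cmDatum L N H).Rational → ℂ} (hΦ : IsOrbitalTerms L N H Φ)
    (hanis : ∀ x : Fin N → L, hermForm (cmConjRingHom L) H x x = 0 → x = 0) :
    ∃ μ : AdelicOrbitalMeasureFamily L N H,
      (∀ c, SMulInvariantMeasure (cmDatum L N H).Adelic _ (μ c) ∧ IsFiniteMeasureOnCompacts (μ c) ∧ μ c ≠ 0) ∧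
      ∃ a : ConjClasses (cmDatum L N H).Rational → ℝ, (∀ c, 0 < a c) ∧
        ∀ (F : C_c((cmDatum L N H).Adelic, ℂ)) (st : StableClass (cmConjRingHom L) H),
          st.orbitalSum (Φ F) = st.orbitalSum fun c => (a c : ℂ) * adelicClassOrbitalIntegral L N H μ F c := by
  obtain ⟨μ, hμ⟩ := exists_adelicOrbitalMeasureFamily_admissible_of_anisotropic L N H hanis
  exact ⟨μ, hμ, IsOrbitalTerms.exists_weight_orbitalSum_eq_of_admissible L N H hΦ μ hμ⟩

variable [MeasurableSpace (cmDatum L N H).Adelic] [BorelSpace (cmDatum L N H).Adelic]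
  (μA : Measure (cmDatum L N H).automorphicQuotient) [(cmDatum L N H).IsAutomorphicMeasure μA]
  (ν : Measure (cmDatum L N H).Adelic) [ν.IsHaarMeasure]

/-- **T1a for the anisotropic `G′` against an honest ALL-CLASSES family, no hypothesis left** (`μA` automorphic, `ν` Haar): there are a family
`μ` of adelic orbital measures admissible at every rational class and weights `a > 0` on the rational classes with, for every `F ∈ C_c(U(H)(𝔸_{L⁺}))`,
`[γ] ↦ a[γ] · Φ_μ(γ, F)` finitely supported and `θ_{G′}(F) = Σᶠ_{𝒪_st} 𝒪_st.orbitalSum ([γ] ↦ a[γ] · Φ_μ(γ, F))`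
(★ `exists_weight_diagTrace_eq_finsum_orbitalSum_of_admissible` at the family of `exists_adelicOrbitalMeasureFamily_admissible_of_anisotropic`).
[cite: Rogawski1990, §14.5 p. 237] -/
theorem exists_weight_diagTrace_eq_finsum_orbitalSum_of_anisotropic
    (hanis : ∀ x : Fin N → L, hermForm (cmConjRingHom L) H x x = 0 → x = 0) :
    ∃ μ : AdelicOrbitalMeasureFamily L N H,
      (∀ c, SMulInvariantMeasure (cmDatum L N H).Adelic _ (μ c) ∧ IsFiniteMeasureOnCompacts (μ c) ∧ μ c ≠ 0) ∧
      ∃ a : ConjClasses (cmDatum L N H).Rational → ℝ, (∀ c, 0 < a c) ∧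
        ∀ F : C_c((cmDatum L N H).Adelic, ℂ),
          (Function.support fun c => (a c : ℂ) * adelicClassOrbitalIntegral L N H μ F c).Finite ∧
          diagTrace L N H μA ν hanis F =
            ∑ᶠ st : StableClass (cmConjRingHom L) H, st.orbitalSum fun c => (a c : ℂ) * adelicClassOrbitalIntegral L N H μ F c := by
  obtain ⟨μ, hμ⟩ := exists_adelicOrbitalMeasureFamily_admissible_of_anisotropic L N H hanis
  exact ⟨μ, hμ, exists_weight_diagTrace_eq_finsum_orbitalSum_of_admissible L N H μA ν hanis μ hμ⟩

end UnitaryGroup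

end Literature.NumberTheory.Automorphic
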